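import Summits.CriticalPhenomena.Ising3DConformalLimit.Theses.BernsteinTemperature

/-!
# Birth skeleton (BC3) for crux `AbsMonotoneTanh` — item stmt-CriticalPhenomena-8357

Route `BernsteinTemperature` (route-CriticalPhenomena-BernsteinTemperature), crux rank 2, concluded BY NAME:
`Summit.CriticalPhenomena.Ising3DConformalLimit.Theses.BernsteinTemperature.AbsMonotoneTanh` — for every
`x ∈ ℤ³` the plus-state two-point function `β ↦ ⟨σ₀σ_x⟩⁺_β` of the n.n. Ising model is, on `[0, β_c(3))`, a
convergent power series in `v = tanh β` with NON-NEGATIVE coefficients `a_n(x)` supported on `n ≥ |x|₁`,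
`n ≡ |x|₁ (mod 2)` (the (AM-v)₃ conjecture; signature fixed by the route, never restated here).

## The line: the route header's own TWO-LAYER PLAN for this node, typed as four named stubs

  (AM)  ⇐  [S1 high-temperature expansion at small β, with geodesic support and bipartite parity]
         + [S2 its (unique) tanh-Taylor coefficients are all ≥ 0]            — the conjectural sign core
         + [S3 β ↦ ⟨σ₀σ_x⟩⁺_β is real analytic on the open interval (0, β_c(3))] — no singularity below β_c
         + [S4 Vivanti–Pringsheim continuation for non-negative series in the variable tanh]  — function theory

* `stub_htExpansion` (S1; classical, M–L in Lean): for every `x` there are `β₀ > 0` and coefficients `a` with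
  `a_n = 0` for `n < |x|₁` or `n ≢ |x|₁ (mod 2)` and `⟨σ₀σ_x⟩⁺_β = Σ_n a_n tanhⁿβ` for `0 ≤ β < β₀`.
  Why true: at small `β` the plus state is the unique Gibbs state (= free state), whose random-current /
  high-temperature graph expansion `Σ_{∂E'={0,x}} v^{|E'|} / Σ_{∂E'=∅} v^{|E'|}` converges in infinite volume by
  the cluster expansion (FriedliVelenik2017 §3.7.3 and Ch. 5; Simon 1993 §V); on the bipartite lattice `ℤ³` a
  subgraph with odd vertices `{0,x}` has `≥ |x|₁` edges and `|E'| ≡ |x|₁ (mod 2)`, an even subgraph has an even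
  number of edges, so the ratio series has the stated support and parity. NO sign claim here.
* `stub_htCoeffNonneg` (S2; OPEN — the hardest stub, the conjecture's combinatorial core): whenever a sequence
  `a` represents `⟨σ₀σ_x⟩⁺_β` as `Σ a_n tanhⁿβ` on some `[0, β₀)`, `β₀ > 0`, then `a_n ≥ 0` for every `n`.
  Power-series coefficients on `[0, tanh β₀)` are unique, so this is positivity of THE infinite-volume HT
  coefficients `a_n(x)`; `n = |x|₁` is GKS, all `n ≤ 15`, `|x|₁ ≤ 4` hold by exact enumeration (item evidence
  AM_coefficients_Z3_order15_addendum.md, refuter 81300ae8-g2); hoped-for engine: a sign-reversing involution on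
  signed clusters of the random-current multigraph expansion (route header, TWO-LAYER PLAN). Why it might fail:
  a signed vacuum correction at some order `n − |x|₁ ≳ 15` (FisherBurford1967, Guttmann1987 tables stop earlier).
* `stub_analyticBelowCritical` (S3; hard, expected): `β ↦ ⟨σ₀σ_x⟩⁺_β` is real analytic on `(0, β_c(3))`.
  Nearest print: Ott2019 (CMP 377) — analyticity of the PRESSURE on `β < β_c`, `h = 0`, from exponential weak
  mixing (sharpness: AizenmanBarskyFernandez1987, DuminilCopinTassionCMP2016); the correlation-function
  companion is the statement here (small `β`: Lebowitz–Penrose / cluster expansion). With S2, Pringsheim's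
  theorem converts "no REAL singularity below β_c" into "no COMPLEX singularity in |v| < v_c".
* `stub_pringsheimTanh` (S4; classical function theory, M; not in Mathlib): if `f` is real analytic on `(0, R)`
  and `f(t) = Σ a_n tanhⁿ t` with `a_n ≥ 0` on some `[0, r)`, `r > 0`, then the same expansion holds on all of
  `[0, R)`. Proof on paper: radius `ρ ≥ tanh r > 0` of `g(v) = Σ a_n vⁿ`; if `ρ < tanh R` then by
  Vivanti–Pringsheim `v = ρ` is a singular point of `g`, while `f ∘ artanh` (identity theorem on `(0, artanh ρ)`,
  `artanh` real analytic on `(-1,1)`) continues `g` analytically across `ρ` — contradiction; so `ρ ≥ tanh R`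
  and the identity theorem on `(0, R)` gives the expansion (at `t = 0` it is the hypothesis). Non-negativity is
  load-bearing: `g(v) = 1/(1 + v/ρ)` is analytic on `[0, ∞)` in `t` but its series stops at `tanh t = ρ`.

`AbsMonotoneTanh_of` takes EXACTLY the four stub statements as hypotheses and concludes the crux BY NAME
(pure logic: S1 gives `β₀, a`, S2 makes `a ≥ 0`, S4 with `f = ⟨σ₀σ_x⟩⁺_·`, `r = β₀`, `R = β_c(3)` and S3
stretches the expansion to `[0, β_c(3))`). The only `sorry`s of the file sit inside the four `stub_*`.

Disproof / negatives: no `Disproof.lean` exists yet for this crux (`ledger crux ls stmt-CriticalPhenomena-8357`: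
no workfiles, 2026-08-17); `ledger negatives --problem CriticalPhenomena` (11 entries) has nothing in this
sub-problem and nothing about HT expansions, analyticity in `β`, or Pringsheim-type continuation.
Skeleton registrar: planner-skel-stmt-CriticalPhenomena-8357-0 (2026-08-17).
-/

namespace Summit.CriticalPhenomena.Ising3DConformalLimit.Cruxes.AbsMonotoneTanh.Birth

open Literature.Probability.LatticeModels
open Summit.CriticalPhenomena.Ising3DConformalLimit.Theses.BernsteinTemperature (AbsMonotoneTanh)

/-! ## Registered stubs (four statements, each spelled out; `AbsMonotoneTanh_of` takes exactly these) -/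

/-- **S1 — infinite-volume high-temperature expansion at small `β`, with geodesic support and bipartite
parity** (classical; M–L): for every `x ∈ ℤ³` there are `β₀ > 0` and `a : ℕ → ℝ`, `a_n = 0` unless
`n ≥ |x|₁` and `n ≡ |x|₁ (mod 2)`, with `⟨σ₀σ_x⟩⁺_β = Σ_n a_n tanhⁿβ` (convergent) for `0 ≤ β < β₀`.
No sign information. [FriedliVelenik2017 §3.7.3, Ch. 5; Simon 1993 §V] -/
theorem stub_htExpansion :
    ∀ x : Site 3, ∃ β₀ : ℝ, 0 < β₀ ∧ ∃ a : ℕ → ℝ,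
      (∀ n, (n < ∑ i, (x i).natAbs ∨ ¬ Even (n + ∑ i, (x i).natAbs)) → a n = 0) ∧
      ∀ β : ℝ, 0 ≤ β → β < β₀ → HasSum (fun n => a n * Real.tanh β ^ n) (twoPointPlus 3 β x) := by
  sorry

/-- **S2 — non-negativity of the tanh-Taylor coefficients** (OPEN; the hardest stub, the sign core of the
whole Bernstein line): any sequence `a` representing `⟨σ₀σ_x⟩⁺_β` as `Σ a_n tanhⁿβ` on some `[0, β₀)`,
`β₀ > 0`, is `≥ 0` termwise (coefficients are unique, so: THE HT coefficients `a_n(x)` are `≥ 0`).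
Exact to `n ≤ 15`, `|x|₁ ≤ 4` (item evidence); `n = |x|₁` is GKS. [FisherBurford1967, Guttmann1987,
OitmaaHamerZheng2006 §2.3, Penrose1963] -/
theorem stub_htCoeffNonneg :
    ∀ (x : Site 3) (a : ℕ → ℝ) (β₀ : ℝ), 0 < β₀ →
      (∀ β : ℝ, 0 ≤ β → β < β₀ → HasSum (fun n => a n * Real.tanh β ^ n) (twoPointPlus 3 β x)) →
      ∀ n, 0 ≤ a n := by
  sorry

/-- **S3 — real analyticity of the two-point function strictly below `β_c`** (hard, expected): for every
`x`, `β ↦ ⟨σ₀σ_x⟩⁺_β` is real analytic at every point of `(0, β_c(3))`. [Ott2019 (pressure analogue),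
AizenmanBarskyFernandez1987, DuminilCopinTassionCMP2016 (exponential decay for β < β_c)] -/
theorem stub_analyticBelowCritical :
    ∀ x : Site 3, AnalyticOnNhd ℝ (fun β : ℝ => twoPointPlus 3 β x) (Set.Ioo 0 (criticalBeta 3)) := by
  sorry

/-- **S4 — Vivanti–Pringsheim continuation in the variable `tanh`** (classical function theory; M, not in
Mathlib): a function real analytic on `(0, R)` which is a power series in `tanh t` with NON-NEGATIVE
coefficients on some `[0, r)`, `r > 0`, is that power series on all of `[0, R)`. (Pringsheim: the radius of a
non-negative series is a singular point; identity theorem; `tanh`, `artanh` real analytic.) The sign hypothesis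
is load-bearing (`1/(1 + v/ρ)`). [Titchmarsh, Theory of Functions §7.21; LavisBell1999 §7.5] -/
theorem stub_pringsheimTanh :
    ∀ (f : ℝ → ℝ) (a : ℕ → ℝ) (r R : ℝ), 0 < r → (∀ n, 0 ≤ a n) →
      (∀ t : ℝ, 0 ≤ t → t < r → HasSum (fun n => a n * Real.tanh t ^ n) (f t)) →
      AnalyticOnNhd ℝ f (Set.Ioo 0 R) →
      ∀ t : ℝ, 0 ≤ t → t < R → HasSum (fun n => a n * Real.tanh t ^ n) (f t) := by
  sorry

/-! ## Composition (sorry-free): the four stub STATEMENTS imply the crux, by name -/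

/-- **COMPOSITION.** S1 → S2 → S3 → S4 → `AbsMonotoneTanh` (the BernsteinTemperature decl of item
stmt-CriticalPhenomena-8357). S1 supplies `β₀ > 0` and the supported coefficient sequence `a`; S2 makes it
non-negative; S4, applied to `f = (β ↦ ⟨σ₀σ_x⟩⁺_β)`, `r = β₀`, `R = β_c(3)` with the analyticity S3, stretches
the expansion from `[0, β₀)` to `[0, β_c(3))`. -/
theorem AbsMonotoneTanh_of :
    (∀ x : Site 3, ∃ β₀ : ℝ, 0 < β₀ ∧ ∃ a : ℕ → ℝ,
      (∀ n, (n < ∑ i, (x i).natAbs ∨ ¬ Even (n + ∑ i, (x i).natAbs)) → a n = 0) ∧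
      ∀ β : ℝ, 0 ≤ β → β < β₀ → HasSum (fun n => a n * Real.tanh β ^ n) (twoPointPlus 3 β x)) →
    (∀ (x : Site 3) (a : ℕ → ℝ) (β₀ : ℝ), 0 < β₀ →
      (∀ β : ℝ, 0 ≤ β → β < β₀ → HasSum (fun n => a n * Real.tanh β ^ n) (twoPointPlus 3 β x)) →
      ∀ n, 0 ≤ a n) →
    (∀ x : Site 3, AnalyticOnNhd ℝ (fun β : ℝ => twoPointPlus 3 β x) (Set.Ioo 0 (criticalBeta 3))) →
    (∀ (f : ℝ → ℝ) (a : ℕ → ℝ) (r R : ℝ), 0 < r → (∀ n, 0 ≤ a n) →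
      (∀ t : ℝ, 0 ≤ t → t < r → HasSum (fun n => a n * Real.tanh t ^ n) (f t)) →
      AnalyticOnNhd ℝ f (Set.Ioo 0 R) →
      ∀ t : ℝ, 0 ≤ t → t < R → HasSum (fun n => a n * Real.tanh t ^ n) (f t)) →
    AbsMonotoneTanh := by
  intro hHT hPos hAn hPr x
  obtain ⟨β₀, hβ₀, a, hsupp, hsum⟩ := hHT x
  have hnonneg : ∀ n, 0 ≤ a n := hPos x a β₀ hβ₀ hsum
  refine ⟨a, hnonneg, hsupp, ?_⟩
  intro β hβ hβc
  exact hPr (fun β' => twoPointPlus 3 β' x) a β₀ (criticalBeta 3) hβ₀ hnonneg hsum (hAn x) β hβ hβc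

/-- The crux from the four registered stubs (shows the stubs have exactly the hypothesis types; its only
`sorry`s are the stubs'). -/
theorem AbsMonotoneTanh_of_stubs : AbsMonotoneTanh :=
  AbsMonotoneTanh_of stub_htExpansion stub_htCoeffNonneg stub_analyticBelowCritical stub_pringsheimTanh

end Summit.CriticalPhenomena.Ising3DConformalLimit.Cruxes.AbsMonotoneTanh.Birth
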